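import Literature.Topology.FourManifolds.BasinPsi
import HarnessLib

/-!
# The basin setting: the radial chart at the minimum — rays are trajectories

Topic `Literature/Topology/FourManifolds`; eighth file of the endgame of the Torelli half of
Griffiths' handlebody theorem.  Everything here is **proved**.

For `B : BasinSetting g ξ` (Milnor's chart `φ` at `p₀`: `g = g p₀ + ‖u - u₀‖²`, `ξ = u - u₀`):
* `BasinSetting.ofChart v`, `BasinSetting.toChart x` — chart coordinates centred at `u₀`, with
  the bookkeeping on the closed chart ball of radius `r₀` (= the sublevel set `{g ≤ sph}`);
* `isMIntegralCurveOn_ray`, `θ_ofChart`, `θ_ofChart'` — **the flow runs along the rays**: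
  `θ (t, ofChart v) = ofChart (eᵗ v)` (Milnor 1965, Def. 3.1 (2); `UnstableSetRadial.lean` for the
  integral curve, backward uniqueness of flow lines, `InteriorFieldFlow.lean`);
* `ofChart_mem_basin`, `mem_basin_of_apply_lt_sph` — the open chart ball lies in the basin;
* `ofChart_smul_toChart` — scaling a point of the ball along its ray by `s ∈ (0, 1]` is flowing
  for the time `log s`.

## References

* J. Milnor, *Lectures on the h-cobordism theorem*, notes by L. Siebenmann and J. Sondow,
  Princeton Mathematical Notes (1965): Def. 3.1, proof of Thm. 3.4 (PDF pp. 11–13), Def. 3.9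
  (PDF p. 16), Thm. 4.1 (PDF p. 22), proof of Thm. 5.4, Assertion 4 (PDF p. 29).
  [MilnorHCobordism1965]
* J. Milnor, *Morse theory* (1963), Thm. 3.1 and proof of Thm. 4.1 (p. 25). [Milnor1963]
* H. B. Griffiths, *Automorphisms of a 3-dimensional handlebody*, Abh. Math. Sem. Univ. Hamburg
  26 (1964), §§3–6. [GriffithsHB1964Handlebody]
-/

open scoped Manifold ContDiff Topology
open Set Function Filter Metric

noncomputable section

namespace Literature.Topology.FourManifolds

open Cobordism FourManifolds.Flow

universe u

variable {n : ℕ} {W : Type u} [TopologicalSpace W] [T2Space W] [SecondCountableTopology W]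
  [CompactSpace W] [ChartedSpace (EuclideanHalfSpace (n + 1)) W] [IsManifold (𝓡∂ (n + 1)) ∞ W]

/-! ### The radial chart at the minimum: rays are trajectories -/

namespace BasinSetting

variable {g : W → ℝ} {ξ : Π x : W, TangentSpace (𝓡∂ (n + 1)) x} (B : BasinSetting g ξ)

/-- The chart coordinate of `p₀`. [folklore] -/
def u₀ : EuclideanSpace ℝ (Fin (n + 1)) := B.φ.extend (𝓡∂ (n + 1)) B.p₀

/-- **The point of `W` with chart coordinate `u₀ + v`** (meaningful for `‖v‖ ≤ r₀`). [cite: MilnorHCobordism1965, Def. 3.1 (2)] -/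
def ofChart (v : EuclideanSpace ℝ (Fin (n + 1))) : W := (B.φ.extend (𝓡∂ (n + 1))).symm (B.u₀ + v)

/-- **The chart coordinate of a point, centred at `u₀`** (meaningful on `φ.source`). [cite: MilnorHCobordism1965, Def. 3.1 (2)] -/
def toChart (x : W) : EuclideanSpace ℝ (Fin (n + 1)) := B.φ.extend (𝓡∂ (n + 1)) x - B.u₀

/-- Unfolding `ofChart`. [folklore] -/
theorem ofChart_def (v : EuclideanSpace ℝ (Fin (n + 1))) :
    B.ofChart v = (B.φ.extend (𝓡∂ (n + 1))).symm (B.u₀ + v) := rfl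

/-- Unfolding `toChart`. [folklore] -/
theorem toChart_def (x : W) : B.toChart x = B.φ.extend (𝓡∂ (n + 1)) x - B.u₀ := rfl

/-- `u₀ + v` lies in the target of the extended chart for `‖v‖ ≤ r₀`. [folklore] -/
theorem add_mem_target {v : EuclideanSpace ℝ (Fin (n + 1))} (hv : ‖v‖ ≤ B.r₀) :
    B.u₀ + v ∈ (B.φ.extend (𝓡∂ (n + 1))).target :=
  B.closedBall_subset (by rw [mem_closedBall, dist_eq_norm, u₀, add_sub_cancel_left]; exact hv)

/-- The source of the extended chart is `φ.source`. [folklore] -/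
theorem extend_source_eq : (B.φ.extend (𝓡∂ (n + 1))).source = B.φ.source := B.φ.extend_source

/-- `ofChart v ∈ φ.source` for `‖v‖ ≤ r₀`. [folklore] -/
theorem ofChart_mem_source {v : EuclideanSpace ℝ (Fin (n + 1))} (hv : ‖v‖ ≤ B.r₀) :
    B.ofChart v ∈ B.φ.source := by
  rw [← extend_source_eq]; exact (B.φ.extend (𝓡∂ (n + 1))).map_target (B.add_mem_target hv)

/-- `toChart (ofChart v) = v` for `‖v‖ ≤ r₀`. [folklore] -/
theorem toChart_ofChart {v : EuclideanSpace ℝ (Fin (n + 1))} (hv : ‖v‖ ≤ B.r₀) :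
    B.toChart (B.ofChart v) = v := by
  rw [toChart_def, ofChart_def, (B.φ.extend (𝓡∂ (n + 1))).right_inv (B.add_mem_target hv),
    add_sub_cancel_left]

/-- `ofChart (toChart x) = x` on `φ.source`. [folklore] -/
theorem ofChart_toChart {x : W} (hx : x ∈ B.φ.source) : B.ofChart (B.toChart x) = x := by
  rw [ofChart_def, toChart_def, add_sub_cancel,
    (B.φ.extend (𝓡∂ (n + 1))).left_inv (by rwa [extend_source_eq])]

/-- `ofChart 0 = p₀`. [folklore] -/
theorem ofChart_zero : B.ofChart 0 = B.p₀ := by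
  rw [ofChart_def, add_zero, u₀, (B.φ.extend (𝓡∂ (n + 1))).left_inv (by rw [extend_source_eq]; exact B.p₀_mem)]

/-- `toChart p₀ = 0`. [folklore] -/
theorem toChart_p₀ : B.toChart B.p₀ = 0 := by rw [toChart_def, u₀, sub_self]

/-- **`g = g p₀ + ‖toChart‖²` on the chart domain.** [cite: MilnorHCobordism1965, Def. 3.1 (2)] -/
theorem apply_eq_of_mem_source {x : W} (hx : x ∈ B.φ.source) : g x = g B.p₀ + ‖B.toChart x‖ ^ 2 :=
  B.g_eq x hx

/-- **`g (ofChart v) = g p₀ + ‖v‖²`** for `‖v‖ ≤ r₀`. [cite: MilnorHCobordism1965, Def. 3.1 (2)] -/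
theorem apply_ofChart {v : EuclideanSpace ℝ (Fin (n + 1))} (hv : ‖v‖ ≤ B.r₀) :
    g (B.ofChart v) = g B.p₀ + ‖v‖ ^ 2 := by
  rw [B.apply_eq_of_mem_source (B.ofChart_mem_source hv), B.toChart_ofChart hv]

/-- Points of the sublevel set `{g ≤ sph}` lie in the chart domain. [cite: Milnor1963, proof of Thm. 4.1 (p. 25)] -/
theorem mem_source_of_apply_le {x : W} (hx : g x ≤ B.sph) : x ∈ B.φ.source := B.sublevel_subset hx

/-- `‖toChart x‖² = g x - g p₀` on `{g ≤ sph}`. [folklore] -/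
theorem norm_toChart_sq {x : W} (hx : g x ≤ B.sph) : ‖B.toChart x‖ ^ 2 = g x - g B.p₀ := by
  have := B.apply_eq_of_mem_source (B.mem_source_of_apply_le hx); linarith

/-- **On `{g ≤ sph}` the chart coordinate has norm `≤ r₀`.** [folklore] -/
theorem norm_toChart_le {x : W} (hx : g x ≤ B.sph) : ‖B.toChart x‖ ≤ B.r₀ := by
  have h := B.norm_toChart_sq hx
  have h' : ‖B.toChart x‖ ^ 2 ≤ B.r₀ ^ 2 := by rw [h]; unfold sph at hx; linarith
  exact (pow_le_pow_iff_left₀ (norm_nonneg _) B.r₀_pos.le two_ne_zero).1 h'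

/-- A point of `{g ≤ sph}` is `ofChart` of its chart coordinate. [folklore] -/
theorem ofChart_toChart_of_apply_le {x : W} (hx : g x ≤ B.sph) : B.ofChart (B.toChart x) = x :=
  B.ofChart_toChart (B.mem_source_of_apply_le hx)

/-- `g (ofChart v) ≤ sph` for `‖v‖ ≤ r₀`. [folklore] -/
theorem apply_ofChart_le_sph {v : EuclideanSpace ℝ (Fin (n + 1))} (hv : ‖v‖ ≤ B.r₀) :
    g (B.ofChart v) ≤ B.sph := by
  rw [B.apply_ofChart hv]; unfold sph
  have := (pow_le_pow_iff_left₀ (norm_nonneg v) B.r₀_pos.le two_ne_zero).2 hv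
  linarith

/-- `g (ofChart v) < sph` for `‖v‖ < r₀`. [folklore] -/
theorem apply_ofChart_lt_sph {v : EuclideanSpace ℝ (Fin (n + 1))} (hv : ‖v‖ < B.r₀) :
    g (B.ofChart v) < B.sph := by
  rw [B.apply_ofChart hv.le]; unfold sph
  have := pow_lt_pow_left₀ hv (norm_nonneg v) two_ne_zero
  linarith

/-! #### Rays are trajectories -/

/-- **The ray `t ↦ ofChart (eᵗ v)` is an integral curve of `ξ`** on `(-∞, 0]`, for `‖v‖ < r₀`
(Milnor's normal form of index `0`: the field is radial in the chart). [cite: MilnorHCobordism1965, Def. 3.1 (2) (PDF p. 12), proof of Thm. 3.12 (PDF p. 18)] -/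
theorem isMIntegralCurveOn_ray {v : EuclideanSpace ℝ (Fin (n + 1))} (hv : ‖v‖ < B.r₀) :
    IsMIntegralCurveOn (fun t => B.ofChart (Real.exp t • v)) ξ (Iic 0) := by
  have hball : ball B.u₀ B.r₀ ⊆ (B.φ.extend (𝓡∂ (n + 1))).target :=
    ball_subset_closedBall.trans B.closedBall_subset
  have hξ : ∀ q ∈ B.φ.source, mfderiv (𝓡∂ (n + 1)) 𝓘(ℝ, EuclideanSpace ℝ (Fin (n + 1)))
      (B.φ.extend (𝓡∂ (n + 1))) q (ξ q) = (fun u => u - B.u₀) (B.φ.extend (𝓡∂ (n + 1)) q) :=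
    fun q hq => B.ξ_eq q hq
  have h := isMIntegralCurveOn_extend_symm_comp B.φ_mem (V := fun u => u - B.u₀) hξ isOpen_ball hball
    (c := fun t => B.u₀ + Real.exp t • v) (s := Iic 0) (fun t ht => ?_) (fun t _ => ?_)
  · exact h
  · rw [mem_ball, dist_eq_norm, add_sub_cancel_left, norm_smul, Real.norm_eq_abs, abs_of_pos (Real.exp_pos t)]
    exact lt_of_le_of_lt (mul_le_of_le_one_left (norm_nonneg v) (Real.exp_le_one_iff.2 ht)) hv
  · have h' : HasDerivAt (fun s => B.u₀ + Real.exp s • v) (Real.exp t • v) t :=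
      ((Real.hasDerivAt_exp t).smul_const v).const_add B.u₀
    simpa using h'

/-- Along the ray, `g` stays in the slab `[lo, hi]`. [folklore] -/
theorem apply_ofChart_mem_slab {v : EuclideanSpace ℝ (Fin (n + 1))} (hv : ‖v‖ ≤ B.r₀) :
    g (B.ofChart v) ∈ Icc B.lo B.hi :=
  ⟨(B.lo_lt_apply _).le, (B.apply_ofChart_le_sph hv).trans (B.sph_lt_L.trans B.L_lt_hi).le⟩

/-- **The flow runs along the rays**: `θ (t, ofChart v) = ofChart (eᵗ v)` for `t ≤ 0`, `‖v‖ < r₀`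
(the ray is an integral curve of `ξ`, hence of the cut-off field, which is `ξ` on the slab;
backward integral curves are backward flow lines). [cite: MilnorHCobordism1965, Def. 3.1 (2), proof of Thm. 3.12 (PDF pp. 12, 18)] -/
theorem θ_ofChart {v : EuclideanSpace ℝ (Fin (n + 1))} (hv : ‖v‖ < B.r₀) {t : ℝ} (ht : t ≤ 0) :
    B.θ (t, B.ofChart v) = B.ofChart (Real.exp t • v) := by
  have hray := B.isMIntegralCurveOn_ray hv
  have hray' : IsMIntegralCurveOn (M := (Cobordism.ofBoundary n W).W) (fun t => B.ofChart (Real.exp t • v))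
      (slabField (c := Cobordism.ofBoundary n W) g ξ B.lo B.hi) (Iic 0) := by
    intro s hs
    have h1 := hray s hs
    have hnorm : ‖Real.exp s • v‖ ≤ B.r₀ := by
      rw [norm_smul, Real.norm_eq_abs, abs_of_pos (Real.exp_pos s)]
      exact (mul_le_of_le_one_left (norm_nonneg v) (Real.exp_le_one_iff.2 hs)).trans hv.le
    have h2 := B.preSlabFlow.slabField_eq (x := B.ofChart (Real.exp s • v)) (B.apply_ofChart_mem_slab hnorm)
    rw [h2]
    exact h1
  have h := B.isSmoothFlow.eq_of_isMIntegralCurveOn_Iic B.preSlabFlow.contMDiff_one_slabField hray' ht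
  simp only [Real.exp_zero, one_smul] at h
  exact h.symm

/-- **The flow runs along the rays, forward**: `θ (t, ofChart v) = ofChart (eᵗ v)` as long as
`eᵗ ‖v‖ < r₀`. [cite: MilnorHCobordism1965, Def. 3.1 (2), proof of Thm. 3.12 (PDF pp. 12, 18)] -/
theorem θ_ofChart' {v : EuclideanSpace ℝ (Fin (n + 1))} {t : ℝ} (ht : 0 ≤ t)
    (hv : Real.exp t * ‖v‖ < B.r₀) : B.θ (t, B.ofChart v) = B.ofChart (Real.exp t • v) := by
  have hv' : ‖Real.exp t • v‖ < B.r₀ := by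
    rwa [norm_smul, Real.norm_eq_abs, abs_of_pos (Real.exp_pos t)]
  have h := B.θ_ofChart hv' (t := -t) (neg_nonpos.2 ht)
  rw [smul_smul, ← Real.exp_add, neg_add_cancel, Real.exp_zero, one_smul] at h
  have h2 : B.θ (t, B.θ (-t, B.ofChart (Real.exp t • v))) = B.θ (t, B.ofChart v) := by rw [h]
  rw [B.θ_add, add_neg_cancel, B.θ_zero] at h2
  exact h2.symm

/-- **The open chart ball lies in the basin.** [cite: MilnorHCobordism1965, Def. 3.1 (2), Def. 3.9] -/
theorem ofChart_mem_basin {v : EuclideanSpace ℝ (Fin (n + 1))} (hv : ‖v‖ < B.r₀) : B.ofChart v ∈ B.basin := by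
  have hξ : ∀ q ∈ B.φ.source, mfderiv (𝓡∂ (n + 1)) 𝓘(ℝ, EuclideanSpace ℝ (Fin (n + 1)))
      (B.φ.extend (𝓡∂ (n + 1))) q (ξ q) = B.φ.extend (𝓡∂ (n + 1)) q - B.φ.extend (𝓡∂ (n + 1)) B.p₀ :=
    fun q hq => B.ξ_eq q hq
  refine mem_unstableSet_of_chart_radial B.φ_mem B.p₀_mem hξ
    (ball_subset_closedBall.trans B.closedBall_subset) (B.ofChart_mem_source hv.le) ?_
  rw [mem_ball, dist_eq_norm]
  have : B.φ.extend (𝓡∂ (n + 1)) (B.ofChart v) - B.φ.extend (𝓡∂ (n + 1)) B.p₀ = B.toChart (B.ofChart v) := rfl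
  rw [this, B.toChart_ofChart hv.le]; exact hv

/-- A point of `{g < sph}` lies in the basin. [folklore] -/
theorem mem_basin_of_apply_lt_sph {x : W} (hx : g x < B.sph) : x ∈ B.basin := by
  have h1 : ‖B.toChart x‖ < B.r₀ := by
    have h := B.norm_toChart_sq hx.le
    have h' : ‖B.toChart x‖ ^ 2 < B.r₀ ^ 2 := by rw [h]; unfold sph at hx; linarith
    exact (pow_lt_pow_iff_left₀ (norm_nonneg _) B.r₀_pos.le two_ne_zero).1 h'
  rw [← B.ofChart_toChart_of_apply_le hx.le]; exact B.ofChart_mem_basin h1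

/-- **Scaling a point of the open chart ball along its ray is flowing**:
`ofChart (s • toChart x) = θ (log s, x)` for `0 < s ≤ 1`. [folklore] -/
theorem ofChart_smul_toChart {x : W} (hx : g x < B.sph) {s : ℝ} (hs : 0 < s) (hs1 : s ≤ 1) :
    B.ofChart (s • B.toChart x) = B.θ (Real.log s, x) := by
  have h1 : ‖B.toChart x‖ < B.r₀ := by
    have h := B.norm_toChart_sq hx.le
    have h' : ‖B.toChart x‖ ^ 2 < B.r₀ ^ 2 := by rw [h]; unfold sph at hx; linarith
    exact (pow_lt_pow_iff_left₀ (norm_nonneg _) B.r₀_pos.le two_ne_zero).1 h'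
  conv_rhs => rw [← B.ofChart_toChart_of_apply_le hx.le]
  rw [B.θ_ofChart h1 (Real.log_nonpos hs.le hs1), Real.exp_log hs]

end BasinSetting

end Literature.Topology.FourManifolds
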